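import Summits.BirchSwinnertonDyer.BirchSwinnertonDyer.Theorems.SignedLowerHalvesKobayashiLowerHalfLargeImageParityStratum
import Literature.NumberTheory.EllipticCurves.Kobayashi2003.SignedSelmerDualExistsProofs
import HarnessLib

/-!
# Route `SignedLowerHalves`, crux 3 `KobayashiLowerHalfLargeImage` (item stmt-BirchSwinnertonDyer-19001):
# the PARITY STRATUM, part 3 — the `T`-ORDER of the signed `p`-adic `L`-functions: its PARITY is the root
# number (Sprung's functional equation), it agrees mod `2` with `corank Sel_{p^∞}(E/ℚ)` (`p`-parity), and it
# BOUNDS that corank from above (Kobayashi's rational Kato divisibility + the signed corank control)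
# (cell `bsd-ssimc`, seat `bsd-line-slh-p1` LEAD gen 12; helper file `--supports 19001`)

HONEST FRAMING: the crux is OPEN; BSD is not proved by any of this. CONDITIONAL theorems on DISPLAYED
binders — the published named facts `Sprung2017.cor414_sharpFlat_functionalEquation_apZero` (`hFE`),
`p_parity W p` (`hpar`), Kobayashi 2003 Thm. 1.2 (`h12`) and Thm. 4.1 in its RATIONAL form (`h41`, no image
hypothesis). CALIBRATION / SUPPORT ONLY (pen rule D34-4 (3)). These are the supersingular (`a_p = 0`,
signed) twins of what the tree proves for the ORDINARY `L_p(E,T)` in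
`Literature/Barriers/BirchSwinnertonDyer/PAdicFunctionalEquationParityProofs` (`ord_T L_p ≡ r_an (mod 2)`)
and `KatoRankBoundSelmerProofs` (`corank Sel ≤ ord_T L_p`), read here on Pollack's `L_p^ε`
(`kobayashiL ε L⁺ L⁻`, Kobayashi's labelling) for the newform of `E` at the conductor level.

## What this file does

* §1 `order_natCast_pow_mul` — `ord_T (pⁿ · L) = ord_T L` in `Λ` (plumbing).
* §2 `rootNumber_eq_neg_one_pow_order` — **`w(E) = (−1)^{ord_T L_p^ε}`** for either sign, granted `hFE`
  (leading coefficient under `T ↦ T^ι`, the tree's `eq_neg_one_pow_of_subst_eq`); hence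
  `even_order_iff_of_signs` — `ord_T L_p^+ ≡ ord_T L_p^- (mod 2)`.
* §3 `even_order_iff_even_selmerCorank` — with `p_parity W p`:
  **`ord_T L_p^ε ≡ corank_{ℤ_p} Sel_{p^∞}(E/ℚ) (mod 2)`**.
* §4 `selmerCorank_le_order` — with `h12` and the RATIONAL Kato side `h41` (`ξ^ε ∣ pⁿ L_p^ε`, no image
  hypothesis): **`corank_{ℤ_p} Sel_{p^∞}(E/ℚ) ≤ ord_T L_p^ε`** — Kato's Thm. 18.4 shape at a supersingular
  prime, through the signed corank control `SignedSelmerDualData.selmerCorank_le_order_of_mem_charIdeal`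
  (p635263) on the datum that exists by `nonempty_signedSelmerDualData` in the cyclotomic frame
  `exists_isCyclotomic_isTopGenerator_isCyclotomicVariable_holds`.
* §5 `selmerCorank_le_one_of_lam_le_one` — on the parity stratum (`μ(L_p^ε) = 0`, `λ(L_p^ε) ≤ 1`):
  `corank Sel_{p^∞}(E/ℚ) ≤ 1`, with equality to `1` iff `λ = 1` (§3/§4 + `T ∣ L_p^ε ⇒ ord_T ≥ 1`).

READING for the crux: on X7 ∧ Surj the three integers `corank Sel_{p^∞}(E/ℚ) ≤ ord_T ξ^ε ≤ ord_T L_p^ε`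
have the outer two of the same parity (§3); the parity stratum of parts 1–2 is `ord_T`-free
(`λ ≤ 1` bounds ALL zeros, not only the one at `T = 0`), which is why it closes the lower half there and
nothing weaker than `λ` does.

References: [Sprung2017] Cor. 4.14; [Pollack2003] Thm. 5.13, Prop. 6.18; [Kobayashi2003] Thm. 1.2, Thm. 4.1;
[DokchitserDokchitserAnnals2010] Thm. 1.4; [GreenbergLNM1716] §1 pp. 67–68, §3 Lemma 3.1, §5 p. 181;
[Kato2004] Thm. 18.4 (the ordinary statement whose shape §4 reproduces).
-/

set_option autoImplicit false
set_option linter.dupNamespace false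

noncomputable section

open scoped Classical MatrixGroups ModularForm

open CongruenceSubgroup PowerSeries WeierstrassCurve Literature.NumberTheory.EllipticCurves
  Literature.NumberTheory.EllipticCurves.ModularForms Literature.Barriers.BirchSwinnertonDyer
  Literature.NumberTheory.EllipticCurves.Rank1Residual Literature.NumberTheory.EllipticCurves.Sprung2017
  Literature.NumberTheory.EllipticCurves.Kobayashi2003 ZpExtension
  Literature.NumberTheory.EllipticCurves.Rank1Residual.Typed
  Summit.BirchSwinnertonDyer.Rank1Residual.X1.MuLambda
  Summit.BirchSwinnertonDyer.Rank1Residual.Supersingular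

namespace Summit.BirchSwinnertonDyer.BirchSwinnertonDyer.Theorems.LargeImageParityStratum

/-! ## §1. Plumbing: `ord_T (pⁿ L) = ord_T L` -/

section Plumbing

variable {p : ℕ} [Fact p.Prime]

/-- In `Λ = ℤ_p⟦T⟧`, multiplying by `pⁿ` does not change the `T`-order (`pⁿ ≠ 0` is a constant). [folklore] -/
theorem order_natCast_pow_mul (n : ℕ) (L : IwasawaAlgebra p) :
    ((p : IwasawaAlgebra p) ^ n * L).order = L.order := by
  have hc : ((p : IwasawaAlgebra p) ^ n) = C ((p : ℤ_[p]) ^ n) := by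
    rw [map_pow, map_natCast]
  have h0 : ((p : IwasawaAlgebra p) ^ n).order = 0 := by
    rw [hc, ← Nat.cast_zero, order_eq_nat]
    refine ⟨?_, fun i hi ↦ (Nat.not_lt_zero i hi).elim⟩
    rw [coeff_zero_C]
    exact pow_ne_zero _ (by exact_mod_cast (Fact.out : p.Prime).ne_zero)
  rw [order_mul, h0, zero_add]

end Plumbing

/-! ## §2. `w(E) = (−1)^{ord_T L_p^ε}` -/

section RootNumber

variable (W : WeierstrassCurve ℚ) [W.IsElliptic] [W.IsGloballyMinimal] (p : ℕ) [Fact p.Prime]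

/-- **The root number is the parity of the `T`-order of Pollack's `L_p^ε`, for either sign.** Let `p`
be an odd good prime of `E = W` with `a_p = 0`, `f ∈ S₂(Γ₀(N_E))` its newform, `(L⁺, L⁻)` a Pollack pair
and `ε` a sign. Granted Sprung's functional equation of the pair (`hFE`, Cor. 4.14 at `a_p = 0`, with sign
`σ = w(E)` at level `N_E` by `rootNumber_eq_neg_frickeEigenvalue` and multiplier `(1+T)^{c+·}` of constant
term `1`): `w(E) = (−1)^{ord_T L_p^ε}` — compare the coefficients of `T^{ord}` under `T ↦ T^ι = −T + O(T²)`
(the tree's `eq_neg_one_pow_of_subst_eq`, Greenberg LNM 1716 §5). The supersingular twin of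
`even_order_padicLFunction_iff_even_analyticRank_conductorLevel`'s mechanism.
[cite: Sprung2017, Cor. 4.14 (a_p = 0 display)] [cite: GreenbergLNM1716, §1 (pp. 67–68) and §5 (p. 181)]
[cite: Pollack2003, Prop. 6.18] -/
theorem rootNumber_eq_neg_one_pow_order
    (hFE : Sprung2017.cor414_sharpFlat_functionalEquation_apZero)
    (hp : p ≠ 2) (hgood : W.HasGoodReductionAtPrime p) (hap : W.frobeniusTrace p = 0)
    [NeZero (W.conductorNorm ℤ)] {f : CuspForm (Gamma0 (W.conductorNorm ℤ)) 2} (hf : IsNewformOf W f)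
    {Lplus Lminus : IwasawaAlgebra p} (hPP : IsPollackPair f p Lplus Lminus) (ε : ℤˣ) :
    W.rootNumber = (-1) ^ (kobayashiL ε Lplus Lminus).order.toNat := by
  -- the sign dictionary at level `N_W`
  have hw : (W.rootNumber : ℂ) = -frickeEigenvalue f :=
    rootNumber_eq_neg_frickeEigenvalue (fun _ _ ↦ IsNewform0.exists_functional_equation_holds)
      (fun _ _ ↦ IsNewform0.frickeEigenvalue_eq_one_or_eq_neg_one_holds) hf
  have hsm := IsNewform0.frickeInvolution_eq_smul_holds (N := W.conductorNorm ℤ) (k := (2 : ℤ)) hf.1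
  have hFr : IsFrickeEigen (W.conductorNorm ℤ) f (frickeEigenvalue f) :=
    isFrickeEigen_of_frickeInvolution_eq_smul _ hsm
  have hWσ : IsFrickeEigen (W.conductorNorm ℤ) f (-((W.rootNumber : ℤ) : ℂ)) := by
    rw [hw, neg_neg]; exact hFr
  have hσ : W.rootNumber ^ 2 = 1 := by
    rcases W.rootNumber_eq_one_or with h | h <;> rw [h] <;> norm_num
  -- the functional equation of the component of sign `ε`
  have hpN : ¬ p ∣ W.conductorNorm ℤ := not_dvd_level_of_isNewformOf hf hgood
  obtain ⟨ηN, c, hc⟩ := exists_teichmuller_exponent_natCast p hpN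
  obtain ⟨a, b, ha, hb⟩ := exists_sprung_exponents (p := p)
  have hSP : IsSprungPair f p 0 Lplus Lminus :=
    (isSprungPair_zero_iff f p Lplus Lminus).mpr ⟨hPP.2.2.1, hPP.2.2.2⟩
  set ι : IwasawaAlgebra p := invOnePlusSubOne with hιdef
  have hι : (1 + X : IwasawaAlgebra p) * (ι + 1) = 1 := one_add_X_mul_invOnePlusSubOne_add_one
  obtain ⟨hs, hfl⟩ := hFE p W (W.conductorNorm ℤ) f hp hf hgood hap W.rootNumber hσ hWσ ηN c hc a b
    ha hb ι hι Lplus Lminus hSP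
  set L := kobayashiL ε Lplus Lminus with hLdef
  obtain ⟨e, he⟩ : ∃ e : ℤ_[p], L.subst ι =
      (W.rootNumber : IwasawaAlgebra p) * binomialSeries ℤ_[p] e * L := by
    rw [hLdef, kobayashiL]
    split_ifs
    · exact ⟨c + b, hfl⟩
    · exact ⟨c + a, hs⟩
  have hL0 : L ≠ 0 := by
    rw [hLdef, kobayashiL]
    split_ifs
    · exact hPP.2.1
    · exact hPP.1
  -- leading coefficient under `T ↦ T^ι`
  have he' : L.subst ι = C ((W.rootNumber : ℤ) : ℤ_[p]) * binomialSeries ℤ_[p] e * L := by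
    rw [he, map_intCast]
  have hord : L.order = (L.order.toNat : ℕ) := (coe_toNat_order hL0).symm
  have key := eq_neg_one_pow_of_subst_eq (constantCoeff_eq_zero_of_one_add_X_mul hι)
    (by rw [hιdef]; exact coeff_one_invOnePlusSubOne) (binomialSeries_constantCoeff (A := ℤ_[p]) e) he' hord
  exact_mod_cast key

/-- **Both signed `p`-adic `L`-functions have `T`-order of the SAME parity** (that of `w(E)`).
[cite: Sprung2017, Cor. 4.14 (a_p = 0 display)] [cite: GreenbergLNM1716, §5 (p. 181)] -/
theorem even_order_iff_of_signs
    (hFE : Sprung2017.cor414_sharpFlat_functionalEquation_apZero)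
    (hp : p ≠ 2) (hgood : W.HasGoodReductionAtPrime p) (hap : W.frobeniusTrace p = 0)
    [NeZero (W.conductorNorm ℤ)] {f : CuspForm (Gamma0 (W.conductorNorm ℤ)) 2} (hf : IsNewformOf W f)
    {Lplus Lminus : IwasawaAlgebra p} (hPP : IsPollackPair f p Lplus Lminus) (ε ε' : ℤˣ) :
    Even (kobayashiL ε Lplus Lminus).order.toNat ↔ Even (kobayashiL ε' Lplus Lminus).order.toNat := by
  have h1 := rootNumber_eq_neg_one_pow_order W p hFE hp hgood hap hf hPP ε
  have h2 := rootNumber_eq_neg_one_pow_order W p hFE hp hgood hap hf hPP ε'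
  rw [h1] at h2
  rw [← neg_one_pow_eq_one_iff_even (R := ℤ) (by norm_num),
    ← neg_one_pow_eq_one_iff_even (R := ℤ) (by norm_num), h2]

end RootNumber

/-! ## §3. `ord_T L_p^ε ≡ corank Sel_{p^∞}(E/ℚ) (mod 2)` -/

section ParityOrder

variable (W : WeierstrassCurve ℚ) [W.IsElliptic] [W.IsGloballyMinimal] (p : ℕ) [Fact p.Prime]

/-- **`ord_T L_p^ε` and `corank_{ℤ_p} Sel_{p^∞}(E/ℚ)` have the same parity**, for either sign, granted the
`p`-parity theorem (`hpar : p_parity W p`, `(−1)^{corank} = w(E)`) and Sprung's functional equation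
(`hFE`): both parities are that of `w(E)` (§2). The supersingular twin of the ordinary
`even_order_padicLFunction_iff_even_analyticRank_conductorLevel`, with the Selmer corank in place of the
analytic rank. [cite: DokchitserDokchitserAnnals2010, Thm. 1.4] [cite: Sprung2017, Cor. 4.14 (a_p = 0 display)]
[cite: GreenbergLNM1716, §5 (p. 181)] -/
theorem even_order_iff_even_selmerCorank
    (hpar : p_parity W p) (hFE : Sprung2017.cor414_sharpFlat_functionalEquation_apZero)
    (hp : p ≠ 2) (hgood : W.HasGoodReductionAtPrime p) (hap : W.frobeniusTrace p = 0)
    [NeZero (W.conductorNorm ℤ)] {f : CuspForm (Gamma0 (W.conductorNorm ℤ)) 2} (hf : IsNewformOf W f)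
    {Lplus Lminus : IwasawaAlgebra p} (hPP : IsPollackPair f p Lplus Lminus) (ε : ℤˣ) :
    Even (kobayashiL ε Lplus Lminus).order.toNat ↔ Even (W.selmerCorank p) := by
  have h1 := rootNumber_eq_neg_one_pow_order W p hFE hp hgood hap hf hPP ε
  have h2 : (-1 : ℤ) ^ W.selmerCorank p = W.rootNumber := hpar
  rw [h1] at h2
  rw [← neg_one_pow_eq_one_iff_even (R := ℤ) (by norm_num),
    ← neg_one_pow_eq_one_iff_even (R := ℤ) (by norm_num), h2]

end ParityOrder

/-! ## §4. `corank Sel_{p^∞}(E/ℚ) ≤ ord_T L_p^ε` (Kato's Thm. 18.4 shape at a supersingular prime) -/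

section KatoBound

variable (W : WeierstrassCurve ℚ) [W.IsElliptic] [W.IsGloballyMinimal] (p : ℕ) [Fact p.Prime]

/-- **`corank_{ℤ_p} Sel_{p^∞}(E/ℚ) ≤ ord_{T=0} L_p^ε(E, T)`** for either sign, at an odd good prime with
`a_p = 0`, for Pollack's `L_p^ε` of the newform `f` of `E` (any level): granted Kobayashi Thm. 1.2 (`h12`:
`X^ε` finitely generated torsion) and the RATIONAL Kato-side divisibility Thm. 4.1 (`h41`:
`ξ^ε ∣ pⁿ L_p^ε`, NO image hypothesis). Proof: in the cyclotomic frame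
(`exists_isCyclotomic_isTopGenerator_isCyclotomicVariable_holds`) a dual datum exists
(`nonempty_signedSelmerDualData`); `corank ≤ ord_T ξ^ε` by the signed corank control
(`SignedSelmerDualData.selmerCorank_le_order_of_mem_charIdeal`, Greenberg Lemma 3.1), and
`ord_T ξ^ε ≤ ord_T (pⁿ L_p^ε) = ord_T L_p^ε`. The supersingular twin of the tree's
`kato_selmerCorank_le_order_padicLFunction_of_kato_divisibility` (Kato Thm. 18.4 from Thm. 17.4).
[cite: Kobayashi2003, Thm. 1.2 (p. 2) and Thm. 4.1 (p. 8)] [cite: GreenbergLNM1716, §1 p. 65 and §3 Lemma 3.1]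
[cite: Kato2004, Thm. 18.4 (p. 281)] -/
theorem selmerCorank_le_order
    (h12 : Kobayashi2003.thm12_signedSelmerDual_finite_torsion)
    (h41 : Kobayashi2003.thm41_signedCharIdeal_divisibility)
    (hp : p ≠ 2) (hgood : W.HasGoodReductionAtPrime p) (hap : W.frobeniusTrace p = 0)
    {N : ℕ} [NeZero N] {f : CuspForm (Gamma0 N) 2} (hf : IsNewformOf W f)
    {Lplus Lminus : IwasawaAlgebra p} (hPP : IsPollackPair f p Lplus Lminus) (ε : ℤˣ) :
    (W.selmerCorank p : ℕ∞) ≤ (kobayashiL ε Lplus Lminus).order := by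
  obtain ⟨κ, hκ, γ, hγ, hγ'⟩ := exists_isCyclotomic_isTopGenerator_isCyclotomicVariable_holds p
  obtain ⟨D⟩ := nonempty_signedSelmerDualData W κ ε hγ (p := p)
  haveI : Module.Finite (IwasawaAlgebra p) D.X := h12.moduleFinite hp hgood hap hκ hγ D
  have hX : Module.IsTorsion (IwasawaAlgebra p) D.X := h12.isTorsion hp hgood hap hκ hγ D
  obtain ⟨ξ, hξ⟩ := (charIdeal_isPrincipal_holds p D.X).principal
  have hξ' : D.charIdeal = Ideal.span {ξ} := hξ
  set L := kobayashiL ε Lplus Lminus with hL_def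
  have hL : IsSignedPAdicLFunction f p ε L := hPP.isSignedPAdicLFunction_kobayashiL ε
  -- `corank ≤ ord ξ`
  have h1 : (W.selmerCorank p : ℕ∞) ≤ ξ.order :=
    D.selmerCorank_le_order_of_mem_charIdeal hγ hX (hξ' ▸ Ideal.mem_span_singleton_self ξ)
  -- `ξ ∣ pⁿ L` (rational Kato side), so `ord ξ ≤ ord (pⁿ L) = ord L`
  obtain ⟨n, h, hh⟩ := h41.exists_dvd_pow_mul hp hgood hap hf hκ hγ hγ' hL D hX hξ'
  have h2 : ξ.order ≤ ((p : IwasawaAlgebra p) ^ n * L).order := by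
    rw [hh]
    exact le_trans le_self_add (le_order_mul ξ h)
  rw [order_natCast_pow_mul] at h2
  exact h1.trans h2

/-- **In particular `ord_T L_p^ε = 0` (i.e. `L_p^ε(0) ≠ 0`, i.e. `L(E,1) ≠ 0` by Kobayashi (3.6)) forces
`corank Sel_{p^∞}(E/ℚ) = 0`** — the rank-zero reading, granted `h12`, `h41` (rational).
[cite: Kobayashi2003, Thm. 1.2 (p. 2) and Thm. 4.1 (p. 8)] [cite: Kato2004, Thm. 18.4 (p. 281)] -/
theorem selmerCorank_eq_zero_of_order_eq_zero
    (h12 : Kobayashi2003.thm12_signedSelmerDual_finite_torsion)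
    (h41 : Kobayashi2003.thm41_signedCharIdeal_divisibility)
    (hp : p ≠ 2) (hgood : W.HasGoodReductionAtPrime p) (hap : W.frobeniusTrace p = 0)
    {N : ℕ} [NeZero N] {f : CuspForm (Gamma0 N) 2} (hf : IsNewformOf W f)
    {Lplus Lminus : IwasawaAlgebra p} (hPP : IsPollackPair f p Lplus Lminus) (ε : ℤˣ)
    (h0 : (kobayashiL ε Lplus Lminus).order = 0) : W.selmerCorank p = 0 := by
  have h := selmerCorank_le_order W p h12 h41 hp hgood hap hf hPP ε
  rw [h0] at h
  exact_mod_cast nonpos_iff_eq_zero.mp h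

end KatoBound

/-! ## §5. On the parity stratum: `corank Sel_{p^∞}(E/ℚ) ≤ 1`, `= 1` iff `λ = 1` -/

section Stratum

variable (W : WeierstrassCurve ℚ) [W.IsElliptic] [W.IsGloballyMinimal] (p : ℕ) [Fact p.Prime]

/-- `ord_T L ≤ λ(L)` in `Λ` when `μ(L) = 0`: the reduction mod `p` of `L` has order `λ(L)`, and a
coefficient that is a unit is non-zero. [cite: GreenbergVatsal2000, p. 2–3, (1)–(2)] -/
theorem order_le_lam_of_mu_eq_zero {L : IwasawaAlgebra p} (hL : L ≠ 0) (hμ : mu L = 0) :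
    L.order ≤ (lam L : ℕ∞) := by
  -- `L = pfree L` since `μ = 0`
  have hdec : L = pfree L := by
    have h := eq_C_pow_mu_mul_pfree L
    rw [hμ, pow_zero, map_one, one_mul] at h
    exact h
  have hred : red (pfree L) ≠ 0 := red_pfree_ne_zero hL
  have hne : coeff (lam L) (red (pfree L)) ≠ 0 := coeff_order hred
  rw [coeff_map] at hne
  have hne' : coeff (lam L) (pfree L) ≠ 0 := fun h ↦ hne (by rw [h, map_zero])
  rw [← hdec] at hne'
  exact order_le (lam L) hne'

/-- **On the parity stratum the `p^∞`-Selmer corank is at most `1`, and equals `1` iff `λ(L_p^ε) = 1`.**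
Odd good `p`, `a_p = 0`, newform `f` of level `N_E`, Pollack pair, sign `ε` with `μ(L_p^ε) = 0` and
`λ(L_p^ε) ≤ 1`; granted `h12`, `h41` (rational), `hpar`, `hFE`. Then `corank ≤ ord_T L_p^ε ≤ λ ≤ 1` (§4,
`order_le_lam_of_mu_eq_zero`), and the parities of `corank` and `ord_T L_p^ε` agree (§3) while
`λ = 1 ⇒ T ∣ L_p^ε ⇒ ord_T = 1` (part 1 §2) and `λ = 0 ⇒ ord_T = 0`.
[cite: Kobayashi2003, Thm. 1.2 and Thm. 4.1] [cite: DokchitserDokchitserAnnals2010, Thm. 1.4]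
[cite: Sprung2017, Cor. 4.14 (a_p = 0 display)] -/
theorem selmerCorank_le_one_of_lam_le_one
    (h12 : Kobayashi2003.thm12_signedSelmerDual_finite_torsion)
    (h41 : Kobayashi2003.thm41_signedCharIdeal_divisibility)
    (hpar : p_parity W p) (hFE : Sprung2017.cor414_sharpFlat_functionalEquation_apZero)
    (hp : p ≠ 2) (hgood : W.HasGoodReductionAtPrime p) (hap : W.frobeniusTrace p = 0)
    [NeZero (W.conductorNorm ℤ)] {f : CuspForm (Gamma0 (W.conductorNorm ℤ)) 2} (hf : IsNewformOf W f)
    {Lplus Lminus : IwasawaAlgebra p} (hPP : IsPollackPair f p Lplus Lminus) (ε : ℤˣ)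
    (hμ : mu (kobayashiL ε Lplus Lminus) = 0) (hlam : lam (kobayashiL ε Lplus Lminus) ≤ 1) :
    W.selmerCorank p ≤ 1 ∧ (W.selmerCorank p = 1 ↔ lam (kobayashiL ε Lplus Lminus) = 1) := by
  set L := kobayashiL ε Lplus Lminus with hL_def
  have hL0 : L ≠ 0 := by
    rw [hL_def, kobayashiL]
    split_ifs
    · exact hPP.2.1
    · exact hPP.1
  have hle : (W.selmerCorank p : ℕ∞) ≤ (lam L : ℕ∞) :=
    (selmerCorank_le_order W p h12 h41 hp hgood hap hf hPP ε).trans (order_le_lam_of_mu_eq_zero p hL0 hμ)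
  have hle' : W.selmerCorank p ≤ lam L := by exact_mod_cast hle
  refine ⟨hle'.trans hlam, ⟨fun h1 ↦ le_antisymm hlam (h1 ▸ hle'), fun h1 ↦ ?_⟩⟩
  -- `λ = 1`: the corank is odd (part 1 §3) and `≤ 1`
  have ho := odd_selmerCorank_of_lam_eq_one W p hpar hFE hp hgood hap hf hPP ε h1
  have hle1 : W.selmerCorank p ≤ 1 := hle'.trans hlam
  rcases Nat.le_one_iff_eq_zero_or_eq_one.mp hle1 with h0 | h1'
  · rw [h0] at ho; exact absurd ho (by decide)
  · exact h1'

end Stratum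

end Summit.BirchSwinnertonDyer.BirchSwinnertonDyer.Theorems.LargeImageParityStratum

end
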